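import Literature.NumberTheory.NumberFields.RayClassFieldAdicCharacterDecomposition
import Literature.NumberTheory.GaloisRepresentations.UnramifiedKummer
import HarnessLib

/-!
# The two integer rings of `K_v` (`𝒪[K_v]` of the valuative structure vs `v.adicCompletionIntegers K`), inertia fixes
# the unramified bases, and the junction `κ_v(res w)⁻¹ = χ_π(w)` AT THE LEVEL OF UNITS (de Shalit II.1.7 / II.4.3)

The GLOBAL files (`RayClassFieldAdicCharacter*`: de Shalit's `κ_v = rayAdicCharacter : Gal(K̄/K(𝔪)) →* (v.adicCompletionIntegers K)ˣ`)
and the LOCAL Coleman / Lubin–Tate files (`lubinTateChar hπ : Γ_{K_v} → 𝒪[K_v]ˣ`, `RelNormCoherentUnits hπ E`, `E ≤ maxUnramified K_v`;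
the series-family package with `e : 𝒪[K_v] →+* ℤ_[2]`) use the two (equal but not definitionally equal) integer rings of
`K_v`: Mathlib's `v.adicCompletionIntegers K = {x : Valued.v x ≤ 1}` and the valuative `𝒪[K_v] = {x : valuation K_v x ≤ 1}`.
`RayClassFieldAdicCharacterLocal.lean` therefore stated the junction `κ_v(res w)⁻¹ = χ_π(w)` only after coercion to `K_v`.
THIS file supplies the plumbing the (e)-assembler needs to feed `κ_v` into the local package:

* §1 `integerEquivAdicCompletionIntegers : 𝒪[v.adicCompletion K] ≃+* v.adicCompletionIntegers K` — the identity on `K_v`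
  (`ValuativeRel.isEquiv`: the two valuations are equivalent), `coe_integerEquivAdicCompletionIntegers(_symm)`;
* §2 `smul_coe_eq_of_mem_inertia` — **an inertia element of `W_{K_v}` fixes every `E ≤ maxUnramified K_v` pointwise**
  (`mem_absInertia_iff_forall_mem_maxUnramified`): the «`σ̃` fixes `E`» clause of `hη` / `relColemanSeries_galAct` for the
  inertia elements supplied by `exists_mem_inertia_forall_absRestrictNormalHom_eq`;
* §3 ★ `unitsMap_integerEquiv_lubinTateChar_eq_inv` — **`χ_π(w) = κ_v(res w)⁻¹` as UNITS** (transported along §1) for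
  `w ∈ I_{K_v}` and every uniformiser `π`, and ★ `unitsMap_lubinTateChar_eq_inv_of_rayAdicCharacter_eq` — for the inertia element `w`
  with `κ_v(res w) = κ_v(g)`: `(e ∘ §1⁻¹)(κ_v g)⁻¹ = e(χ_π(w))` in `ℤ_[p]ˣ` for any `e`, i.e. the last clause of `hη` of
  `PAdicOneVariableSeriesFamilyOf(Rel)NormCoherentUnits` holds with the character `κ := ((Units.map e') ∘ κ_v)⁻¹`,
  `e' = e ∘ §1⁻¹` (SIGN: the tree's `κ_v` is the INVERSE of the Lubin–Tate character under `res`).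

One small definition with body (§1); theorems otherwise; no named facts, no instances, no `sorry`.

## References
* [deShalit1987] E. de Shalit, *Iwasawa theory of elliptic curves with complex multiplication* (1987), I.3.3 (9) (p. 18),
  II.1.7 (p. 41), II.1.10 Corollary (p. 39), II.4.3 (p. 57).
* [NeukirchANT1999] J. Neukirch, *Algebraic Number Theory* (1999), Ch. II §3–§4 (equivalent valuations), Ch. VI §5 Prop. (5.6).
* [SerreLocalFields1979] J.-P. Serre, *Local Fields*, Ch. IV §4 Cor. 2 to Prop. 16 (inertia and `F^{nr}`).
* [LubinTate1965] J. Lubin, J. Tate, *Formal complex multiplication in local fields* (1965), Thm. 3.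
-/

noncomputable section

open NumberField IsDedekindDomain IsDedekindDomain.HeightOneSpectrum Field
open scoped nonZeroDivisors Classical

namespace Literature.NumberTheory.NumberFields

open Literature.NumberTheory.GaloisRepresentations
open Literature.NumberTheory.GaloisRepresentations.ArtinLocalGlobal
open Literature.NumberTheory.GaloisRepresentations.IsNonarchimedeanLocalField

variable {K : Type} [Field K] [NumberField K] {𝔪 : Ideal (𝓞 K)} (v : HeightOneSpectrum (𝓞 K))

/-! ### §1. `𝒪[K_v] ≃+* v.adicCompletionIntegers K` -/

section IntegerRings

open ValuativeRel

/-- Membership in the two integer rings of `K_v` agrees (the valuations are equivalent).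
[cite: NeukirchANT1999, Ch. II §3 Prop. (3.8), §4 Prop. (4.1)] -/
theorem mem_integer_iff_mem_adicCompletionIntegers (x : v.adicCompletion K) :
    x ∈ (valuation (v.adicCompletion K)).integer ↔ x ∈ v.adicCompletionIntegers K := by
  rw [Valuation.mem_integer_iff, mem_adicCompletionIntegers]
  exact ((ValuativeRel.isEquiv (Valued.v : Valuation (v.adicCompletion K) (WithZero (Multiplicative ℤ)))
    (valuation (v.adicCompletion K))).le_one_iff_le_one).symm

/-- **`𝒪[K_v] ≃+* v.adicCompletionIntegers K`**, the identity on `K_v`: the integer ring of the valuative structure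
(home of the Lubin–Tate character and of the Coleman files' `e : 𝒪[K_v] →+* ℤ_[p]`) and Mathlib's `v`-adic integers
(home of `κ_v = rayAdicCharacter`). [cite: NeukirchANT1999, Ch. II §4 Prop. (4.1)] -/
def integerEquivAdicCompletionIntegers : 𝒪[v.adicCompletion K] ≃+* v.adicCompletionIntegers K where
  toFun x := ⟨(x : v.adicCompletion K), (mem_integer_iff_mem_adicCompletionIntegers v _).mp x.2⟩
  invFun y := ⟨(y : v.adicCompletion K), (mem_integer_iff_mem_adicCompletionIntegers v _).mpr y.2⟩
  left_inv _ := Subtype.ext rfl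
  right_inv _ := Subtype.ext rfl
  map_mul' _ _ := Subtype.ext rfl
  map_add' _ _ := Subtype.ext rfl

/-- Unfolding: `(§1 x : K_v) = x`. [cite: NeukirchANT1999, Ch. II §4 Prop. (4.1)] -/
@[simp] theorem coe_integerEquivAdicCompletionIntegers (x : 𝒪[v.adicCompletion K]) :
    ((integerEquivAdicCompletionIntegers v x : v.adicCompletionIntegers K) : v.adicCompletion K) =
      (x : v.adicCompletion K) := rfl

/-- Unfolding: `(§1⁻¹ y : K_v) = y`. [cite: NeukirchANT1999, Ch. II §4 Prop. (4.1)] -/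
@[simp] theorem coe_integerEquivAdicCompletionIntegers_symm (y : v.adicCompletionIntegers K) :
    (((integerEquivAdicCompletionIntegers v).symm y : 𝒪[v.adicCompletion K]) : v.adicCompletion K) =
      (y : v.adicCompletion K) := rfl

/-- Unfolding on units: `(§1 u : K_v) = u`. [cite: NeukirchANT1999, Ch. II §4 Prop. (4.1)] -/
theorem coe_unitsMap_integerEquivAdicCompletionIntegers (u : (𝒪[v.adicCompletion K])ˣ) :
    (((Units.map (integerEquivAdicCompletionIntegers v : 𝒪[v.adicCompletion K] →* v.adicCompletionIntegers K) u :
        (v.adicCompletionIntegers K)ˣ) : v.adicCompletionIntegers K) : v.adicCompletion K) =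
      (((u : (𝒪[v.adicCompletion K])ˣ) : 𝒪[v.adicCompletion K]) : v.adicCompletion K) := rfl

/-- Two units of `v.adicCompletionIntegers K` with the same image in `K_v` are equal. [folklore] -/
private theorem units_ext_coe {u₁ u₂ : (v.adicCompletionIntegers K)ˣ}
    (h : (((u₁ : (v.adicCompletionIntegers K)ˣ) : v.adicCompletionIntegers K) : v.adicCompletion K) =
      (((u₂ : (v.adicCompletionIntegers K)ˣ) : v.adicCompletionIntegers K) : v.adicCompletion K)) : u₁ = u₂ :=
  Units.ext (Subtype.ext h)

end IntegerRings

/-! ### §2. Inertia elements fix the unramified bases -/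

/-- **An inertia element of `W_{K_v}` fixes every `E ≤ maxUnramified K_v` pointwise** (`I = Gal(K̄_v/K_v^{nr})`): the
«`σ̃` fixes `E`» clause of `hη` (`PAdicOneVariableSeriesFamilyOf(Rel)NormCoherentUnits`) / of `relColemanSeries_galAct`
for the inertia elements of `exists_mem_inertia_forall_absRestrictNormalHom_eq`.
[cite: SerreLocalFields1979, Ch. IV §4 Cor. 2 to Prop. 16] [cite: deShalit1987, II.1.10 Corollary (p. 39)] -/
theorem smul_coe_eq_of_mem_inertia {w : WeilGroup (v.adicCompletion K)}
    (hwI : w ∈ WeilGroup.inertia (v.adicCompletion K))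
    {E : IntermediateField (v.adicCompletion K) (AlgebraicClosure (v.adicCompletion K))}
    (hE : E ≤ maxUnramified (v.adicCompletion K)) (x : E) :
    WeilGroup.toAbsGalois (v.adicCompletion K) w • ((x : E) : AlgebraicClosure (v.adicCompletion K)) =
      ((x : E) : AlgebraicClosure (v.adicCompletion K)) :=
  (mem_absInertia_iff_forall_mem_maxUnramified.1 (WeilGroup.mem_inertia_iff.1 hwI)) _ (hE x.2)

/-! ### §3. The junction at the level of units -/

variable {v} [IsTotallyComplex K]

open ValuativeRel in
/-- ★ **`χ_π(w) = §1⁻¹(κ_v(res w))⁻¹` as units of `𝒪[K_v]`** for `w ∈ I_{K_v}` and EVERY uniformiser `π` of `K_v` (THE pinned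
Artin map): the units form of `coe_rayAdicCharacter_absGaloisRestrict_inv_eq_lubinTateChar`.
[cite: deShalit1987, II.1.7 (p. 41), II.4.3 (p. 57)] [cite: LubinTate1965, Thm. 3] -/
theorem unitsMap_integerEquiv_lubinTateChar_eq_inv (h𝔪 : 𝔪 ≠ ⊥) (hv : ¬ 𝔪 ≤ v.asIdeal)
    (hw : ∀ u : (𝓞 K)ˣ, (u : 𝓞 K) - 1 ∈ 𝔪 → u = 1)
    {π : 𝒪[v.adicCompletion K]} (hπ : (valuation (v.adicCompletion K)).IsUniformizer (π : v.adicCompletion K))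
    {w : WeilGroup (v.adicCompletion K)} (hwI : w ∈ WeilGroup.inertia (v.adicCompletion K)) :
    Units.map (integerEquivAdicCompletionIntegers v : 𝒪[v.adicCompletion K] →* v.adicCompletionIntegers K)
        (lubinTateChar hπ (WeilGroup.toAbsGalois (v.adicCompletion K) w)) =
      (rayAdicCharacter h𝔪 hv hw ⟨absGaloisRestrict K (v.adicCompletion K)
          (WeilGroup.toAbsGalois (v.adicCompletion K) w),
        absGaloisRestrict_toAbsGalois_mem_ker_rayClassField h𝔪 hv
          (isLocalArtinMap_canonicalArtin_holds (v.adicCompletion K)) hwI⟩)⁻¹ :=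
  units_ext_coe v (by
    rw [coe_unitsMap_integerEquivAdicCompletionIntegers,
      coe_rayAdicCharacter_absGaloisRestrict_inv_eq_lubinTateChar h𝔪 hv hw hπ hwI])

open ValuativeRel in
/-- ★ **The last clause of `hη`**: for `g ∈ Gal(K̄/K(𝔪))` and an inertia element `w` with `κ_v(res w) = κ_v(g)` (supplied by
`exists_mem_inertia_forall_absRestrictNormalHom_eq`), and ANY `e : 𝒪[K_v] →+* ℤ_[p]`:
`e(χ_π(w)) = ((e ∘ §1⁻¹)(κ_v g))⁻¹` — so `hη` holds for the character `κ := ((Units.map (e ∘ §1⁻¹)) ∘ κ_v)⁻¹` (the tree's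
`κ_v` is the inverse of the Lubin–Tate character under `res`; `hU`/`hκ` are inversion-invariant).
[cite: deShalit1987, I.3.3 (9) (p. 18), II.1.7 (p. 41)] [cite: LubinTate1965, Thm. 3] -/
theorem unitsMap_lubinTateChar_eq_inv_of_rayAdicCharacter_eq {p : ℕ} [Fact p.Prime] (h𝔪 : 𝔪 ≠ ⊥)
    (hv : ¬ 𝔪 ≤ v.asIdeal) (hw : ∀ u : (𝓞 K)ˣ, (u : 𝓞 K) - 1 ∈ 𝔪 → u = 1)
    {π : 𝒪[v.adicCompletion K]} (hπ : (valuation (v.adicCompletion K)).IsUniformizer (π : v.adicCompletion K))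
    (e : 𝒪[v.adicCompletion K] →+* ℤ_[p]) (g : ↥(absRestrictNormalHom (rayClassField K 𝔪)).ker)
    {w : WeilGroup (v.adicCompletion K)} (hwI : w ∈ WeilGroup.inertia (v.adicCompletion K))
    (hκ : rayAdicCharacter h𝔪 hv hw ⟨absGaloisRestrict K (v.adicCompletion K)
          (WeilGroup.toAbsGalois (v.adicCompletion K) w),
        absGaloisRestrict_toAbsGalois_mem_ker_rayClassField h𝔪 hv
          (isLocalArtinMap_canonicalArtin_holds (v.adicCompletion K)) hwI⟩ = rayAdicCharacter h𝔪 hv hw g) :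
    Units.map (e : 𝒪[v.adicCompletion K] →* ℤ_[p]) (lubinTateChar hπ (WeilGroup.toAbsGalois (v.adicCompletion K) w)) =
      (Units.map ((e.comp (integerEquivAdicCompletionIntegers v).symm.toRingHom :
          v.adicCompletionIntegers K →+* ℤ_[p]) : v.adicCompletionIntegers K →* ℤ_[p])
        (rayAdicCharacter h𝔪 hv hw g))⁻¹ := by
  have h1 := unitsMap_integerEquiv_lubinTateChar_eq_inv h𝔪 hv hw hπ hwI
  rw [hκ] at h1
  have key : (e : 𝒪[v.adicCompletion K] →* ℤ_[p]) =
      ((e.comp (integerEquivAdicCompletionIntegers v).symm.toRingHom : v.adicCompletionIntegers K →+* ℤ_[p]) :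
          v.adicCompletionIntegers K →* ℤ_[p]).comp
        (integerEquivAdicCompletionIntegers v : 𝒪[v.adicCompletion K] →* v.adicCompletionIntegers K) := by
    refine MonoidHom.ext fun x => ?_
    simp only [MonoidHom.coe_comp, MonoidHom.coe_coe, RingHom.coe_comp, Function.comp_apply]
    exact congrArg e ((integerEquivAdicCompletionIntegers v).symm_apply_apply x).symm
  rw [key, Units.map_comp, MonoidHom.comp_apply, h1, map_inv]

end Literature.NumberTheory.NumberFields

end
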